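import Literature.NumberTheory.EllipticCurves.GlobalMinimalModel
import Literature.NumberTheory.EllipticCurves.Isogeny
import Mathlib.NumberTheory.Padics.PadicVal.Basic
import HarnessLib

/-!
# Dokchitser–Dokchitser 2015, Thm. 5.1 (1) (`l ≠ p` clause): at a prime of potentially good
# reduction the valuation of the minimal discriminant is unchanged by an isogeny of degree prime
# to the residue characteristic — ONE named fact (statement only)

Topic `Literature/NumberTheory/EllipticCurves`; namespace `Literature.NumberTheory.EllipticCurves`.
Sibling of `DokchitserDokchitser2015/TateCurvePIsogenyValuation.lean` (Thm. A.1 of the same paper,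
the potentially multiplicative column of its Table 1); this file types the potentially GOOD column.
No definition of a new notion, no `instance`, no notation, no `sorry`; +1 declared debt (D-0026).

## The print (T. Dokchitser, V. Dokchitser, *Local invariants of isogenous elliptic curves*, Trans.
## Amer. Math. Soc. 367 (2015) 4339–4358 = arXiv:1208.5519, store `paper:arxiv-1208.5519`; TAMS
## numbering, arXiv numbering in brackets)

* §1.1 Notation (p. 4341; store p0004 L23–33): "Throughout the paper `p` is a prime number, and
  `φ : E → E′` an isogeny of elliptic curves of degree `p`. … the base field `K` is a finite
  extension of `ℚ_l`; `l = p` is allowed", "`Δ, Δ′` minimal discriminants of `E/K` and `E′/K`",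
  "`δ, δ′` their valuations: `δ = v(Δ), δ′ = v(Δ′)`".
* §1 (p. 4339; store p0003 L6–8): "As every isogeny factors as a composition of endomorphisms and
  isogenies of prime degree, throughout the paper we just consider a fixed isogeny … of prime
  degree `p`."
* **Theorem 5.1 (1)** [Thm. 19 (1)] (§5 "Discriminants and Kodaira types II"; store p0009 L3–6),
  VERBATIM: "If `E` has potentially good reduction, and either `l ≠ p` or the reduction is good or
  potentially ordinary, then `δ = δ′`."  Its proof for `l ≠ p` (store p0009 L20–26): the leading term
  `φ^*ω′/ω` on Néron differentials is then unchanged by base change to any `F/K` ("for any `F/K`"),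
  and over a field `F` where `E` has good reduction both minimal discriminants are units, whence
  `δ = δ′` over `K` ("the claim for `E/F` implies that for `E/K`").
* Table 1 (p. 4340; store p0003 L62–69), row "additive pot. good, `l ≠ p` — all other cases":
  `δ = δ′`, `φ^*ω′/ω = 1`; Theorem 5.4 (1) [Thm. 22 (1)] (store p0009 L71–72): "If `E` has
  potentially good reduction and `p ≠ l`, then the Kodaira types of `E` and `E′` are the same."

## What is typed, and why it follows from the page

Over `ℚ`, read at the completion `ℚ_p` (the tree's prime `p` is the print's residue characteristic
`l`; the print's isogeny degree `p` is the tree's `φ.degree`): for elliptic `W, W′/ℚ` given by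
GLOBALLY MINIMAL Weierstrass models (so the model is minimal at `p` and
`padicValInt p W.minimalDiscriminantInt = v_p(Δ_min) = δ` of `W ⊗ ℚ_p`, Silverman AEC VIII.8), a
`ℚ`-isogeny `φ : W → W′` (the tree's `WeierstrassCurve.Isogeny`, degree `= #ker φ(ℚ̄)` in
characteristic `0`) whose degree is NOT divisible by `p`, and `W` of potentially good reduction at
`p` (`0 ≤ v_p(j(W))`: Silverman AEC VII.5.5, "potentially good reduction iff `j` is integral"):
`v_p(Δ_min(W)) = v_p(Δ_min(W′))`. From the print: over `ℚ` the isogeny is `ψ ∘ [n]` with `ψ`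
cyclic (`n² · deg ψ = deg φ`, so `p ∤ deg ψ`), `[n]` is an endomorphism of `W` (changes nothing),
and a cyclic `ℚ`-isogeny of degree `d` factors over `ℚ` into `ℚ`-isogenies of prime degrees
`p_i ∣ d`, each `p_i ≠ p` = the print's "`l ≠ p`"; every intermediate curve is again potentially
good at `p` (isogenous curves have simultaneously integral `j` at `p`, Silverman AEC VII.5.5 with
VII.7.2), so Thm. 5.1 (1) applies to each factor over `K = ℚ_p` and the valuations agree along the
chain. Only the clause `l ≠ p` is transcribed — NOT the clause "good or potentially ordinary" with
`l = p` (which would need the tree's potential-ordinarity vocabulary), NOT parts (2)–(3)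
(multiplicative / potentially multiplicative; cf. the sibling file and
`PastenHeightBoundsLemma68LocalProofs.lean`), NOT the Kodaira-type or Tamagawa columns of Table 1.
WHY `p ∤ deg`: at `l = p` with potentially supersingular reduction the conclusion fails (op. cit.
§5, the Remark after Thm. 5.1 [Rem. 21], store p0009 L57–66: `E = 50b1`, `E′ = 50b3`,
`5`-isogenous, types II and II* at `5`, `δ ≠ δ′`).

## Consumer

Route `AdditiveKolyvaginRoad` (W-ALL row 2), Manin-good frames at an additive `p ≥ 11`
(`Summits/…/Theorems/AdditiveKolyvaginRoadManinFrameOffExceptionClass.lean`): Edixhoven 1991 Thm. 3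
is read on the STRONG curve `W₀ ∼ W`; its exception bit "Kodaira type II/III/IV at `p`"
(`ord_p Δ_min ≤ 4`) moves inside the tree at most by `v ↦ 12 − v` along a (G)-class
(`Summit.….Additive.padicValInt_minimalDiscriminantInt_eq_or_add_eq_twelve_of_isIsogenous_of_typeG`);
with `E[p]` irreducible a cyclic `W → W₀` has degree prime to `p`, and this fact pins `v`, so the
exception may be read on ANY member of the class.

## References
* [DokchitserDokchitser2015LocalInvariants] T. Dokchitser, V. Dokchitser, Trans. Amer. Math. Soc.
  367 (2015) 4339–4358, Thm. 5.1 (1), Thm. 5.4 (1), Table 1; arXiv:1208.5519 Thm. 19, Thm. 22.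
* [SilvermanAEC2009] J. H. Silverman, *The Arithmetic of Elliptic Curves*, Prop. VII.5.5,
  Cor. VII.7.2, §VIII.8.
-/

namespace Literature.NumberTheory.EllipticCurves

open WeierstrassCurve

/-- **Dokchitser–Dokchitser 2015, Thm. 5.1 (1), clause `l ≠ p` (an isogeny of degree prime to the
residue characteristic preserves the valuation of the minimal discriminant at a prime of
potentially good reduction).** Printed (Trans. AMS 367, §5 Thm. 5.1; arXiv:1208.5519 Thm. 19 (1),
store `paper:arxiv-1208.5519` p0009 L3–6): "If `E` has potentially good reduction, and either
`l ≠ p` or the reduction is good or potentially ordinary, then `δ = δ′`" — `φ : E → E′` an isogeny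
of prime degree `p` over a finite extension `K` of `ℚ_l`, `δ, δ′` the valuations of the minimal
discriminants (§1.1); Table 1 (p. 4340) row "additive pot. good, `l ≠ p`": `δ = δ′`; §1: "every
isogeny factors as a composition of endomorphisms and isogenies of prime degree". DATA: `W, W′/ℚ`
elliptic, globally minimal models (minimal at `p`, so `δ = padicValInt p W.minimalDiscriminantInt`);
a `ℚ`-isogeny `φ : W → W′` with `¬ p ∣ φ.degree` (every prime-degree factor has degree `≠ p` —
the print's `l ≠ p`; endomorphism factors change nothing); HYPOTHESIS `0 ≤ v_p(j(W))` (`W`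
potentially good at `p`, Silverman AEC VII.5.5). CONCLUSION:
`v_p(Δ_min(W)) = v_p(Δ_min(W′))`. Only this clause of Thm. 5.1 is transcribed (module docstring:
dictionary, what is NOT transcribed, why `p ∤ deg` — [Rem. 21]: `50b1 → 50b3` at `l = p = 5`).
PUBLISHED (refereed). Named fact (statement only).
[cite: DokchitserDokchitser2015LocalInvariants, Thm. 5.1 (1) (arXiv:1208.5519 Thm. 19 (1), store p0009 L3–6) with Table 1 (p. 4340) and §1.1 (p. 4341)]
[cite: SilvermanAEC2009, Prop. VII.5.5 (potentially good reduction iff j integral)] -/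
def dokchitser_padicValInt_minimalDiscriminantInt_eq_of_isogeny_of_not_dvd_degree : Prop :=
  ∀ (W W' : WeierstrassCurve ℚ) [W.IsElliptic] [W'.IsElliptic] [W.IsGloballyMinimal]
    [W'.IsGloballyMinimal] (φ : Isogeny W W') (p : ℕ), p.Prime → ¬ p ∣ φ.degree →
    0 ≤ padicValRat p W.j →
    padicValInt p W.minimalDiscriminantInt = padicValInt p W'.minimalDiscriminantInt

end Literature.NumberTheory.EllipticCurves
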